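import Mathlib
import Literature.Analysis.OperatorTheory.HolomorphicConeFamily
import Literature.MathematicalPhysics.QuantumFieldTheory.PointwiseOSReconstruction
import HarnessLib

/-!
# The Osterwalder–Schrader boost calculus of a pointwise correlation family along a coordinate axis

For a pointwise correlation family `S : CorrFamily 3` (e.g. a scaling limit of lattice correlators)
and the time axis `e₀`, the OS kernel `K(a, b) = S(θ₀ a ⊔ b)` on half-space configurations
(`PointwiseOSReconstruction.osPointKernel`, `τ = 0`) is realised by kernel vectors `δ : X → H`,
`⟪δ_a, δ_b⟫ = K(a, b)`, in some complex Hilbert space (any Kolmogorov decomposition; the results do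
not depend on the choice). From two correlation INEQUALITIES stated with real coefficients —

* the in-plane light cone `hLC` (matrix elements of `e^{-tH} U(y)` between cluster vectors continue to
  the tube `|Im y| < Re t`, bounded by the OS norms; Glimm–Jaffe, *Quantum Physics* (1987), §19.5), and
* the two-sided one-spin sandwich bound `hSB` (`‖e^{-uH} σ̂(y) e^{-vH}‖ ≤ C (u^{-Δ} + v^{-Δ})`),

— we build the two operator families of the boost calculus (`exists_boostCalculus`): the holomorphic
cone family `N(t, y)` "`= e^{-tH + iyP}`" (`HolomorphicConeFamily.exists_coneFamily`) reproducing the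
shifted clusters `N(t, y) δ_b = δ_{b + t e₀ + y e₁}` (`HalfSpaceConfig.shift`), and the insertions
`B_w` "`= e^{-uH} σ̂(w e₂) e^{-uH}`" with `‖B_w‖ ≤ 8 |C| u^{-Δ}` reproducing `δ_{spinCons}`
(`HalfSpaceConfig.spinCons`: the spin at height `u` on top of the cluster pushed up by `2u`), using
translation invariance to identify the sandwich matrix with a column of the OS kernel
(`sandwichKernel_eq_osPointKernel`).

## References
* J. Glimm, A. Jaffe, *Quantum Physics* (2nd ed. 1987), §6.1, §19.1, §19.5.
* K. Osterwalder, R. Schrader, CMP 31 (1973) §4.1; CMP 42 (1975) §V.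
-/

noncomputable section

open Filter ComplexConjugate Complex
open scoped InnerProductSpace Topology
open Literature.Probability.LatticeModels
open Literature.Analysis.OperatorTheory Literature.Analysis.OperatorTheory.KernelVectors
  Literature.Analysis.Complex

namespace Literature.MathematicalPhysics.QuantumFieldTheory

local notation "E³" => EuclideanSpace ℝ (Fin 3)
local notation "e₀" => EuclideanSpace.single (0 : Fin 3) (1 : ℝ)
local notation "e₁" => EuclideanSpace.single (1 : Fin 3) (1 : ℝ)
local notation "e₂" => EuclideanSpace.single (2 : Fin 3) (1 : ℝ)

/-! ## Two operations on half-space configurations -/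

namespace HalfSpaceConfig

/-- The shift of a configuration by `t e₀ + y e₁` (time `t`, truncated at `0`, and transverse `y`). [folklore] -/
def shift (t y : ℝ) (b : HalfSpaceConfig 3 0) : HalfSpaceConfig 3 0 :=
  b.translate (max t 0 • e₀ + y • e₁) (by simp)

/-- The shift keeps the number of points. [folklore] -/
@[simp] theorem shift_n (t y : ℝ) (b : HalfSpaceConfig 3 0) : (b.shift t y).n = b.n := rfl

/-- The points of a shifted configuration (`t ≥ 0`). [folklore] -/
theorem shift_pts {t : ℝ} (ht : 0 ≤ t) (y : ℝ) (b : HalfSpaceConfig 3 0) :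
    (b.shift t y).pts = fun i => b.pts i + t • e₀ + y • e₁ := by
  funext i
  simp only [shift, translate_pts, max_eq_left ht, add_assoc]

/-- **Inserting a spin below a cluster**: the new point `u e₀ + w e₂` (height `u > 0`, on the axis
through the mirror plane point `w e₂`) in front of the cluster `b` pushed up by `2u e₀`. [folklore] -/
def spinCons {u : ℝ} (hu : 0 < u) (w : ℝ) (b : HalfSpaceConfig 3 0) : HalfSpaceConfig 3 0 where
  n := b.n + 1
  pts := Fin.cons (u • e₀ + w • e₂) (fun i => b.pts i + (2 * u) • e₀)
  injective := by
    refine Fin.cons_injective_iff.2 ⟨?_, (add_left_injective _).comp b.injective⟩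
    rintro ⟨i, hi⟩
    have h := congrArg (fun z : E³ => z 0) hi
    have hp := b.pos i
    simp at h
    linarith
  pos := fun i => by
    refine Fin.cases ?_ (fun j => ?_) i
    · simp [hu]
    · have := b.pos j
      simp
      linarith

/-- The number of points after inserting a spin. [folklore] -/
@[simp] theorem spinCons_n {u : ℝ} (hu : 0 < u) (w : ℝ) (b : HalfSpaceConfig 3 0) :
    (b.spinCons hu w).n = b.n + 1 := rfl

/-- The points after inserting a spin. [folklore] -/
@[simp] theorem spinCons_pts {u : ℝ} (hu : 0 < u) (w : ℝ) (b : HalfSpaceConfig 3 0) :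
    (b.spinCons hu w).pts = Fin.cons (u • e₀ + w • e₂) (fun i => b.pts i + (2 * u) • e₀) := rfl

end HalfSpaceConfig

/-! ## Kernel identities -/

/-- Reindexing the argument of `S` along a cast (restated from `corrFamily_comp_cast` for chains of casts). [folklore] -/
theorem corrFamily_comp_cast' (S : CorrFamily 3) {m n : ℕ} (hmn : m = n) (x : Fin n → E³) (y : Fin m → E³)
    (h : y = x ∘ Fin.cast hmn) : S m y = S n x := by
  subst h; exact corrFamily_comp_cast S hmn x

/-- The OS kernel against a shifted configuration. [folklore] -/
theorem osPointKernel_shift (S : CorrFamily 3) (a b : HalfSpaceConfig 3 0) {t : ℝ} (ht : 0 ≤ t) (y : ℝ) :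
    osPointKernel S a (b.shift t y) =
      S (a.n + b.n) (Fin.append (fun i => axisReflection 0 (a.pts i)) (fun j => b.pts j + t • e₀ + y • e₁)) := by
  simp only [osPointKernel, HalfSpaceConfig.shift_n, HalfSpaceConfig.shift_pts ht]

/-- `θ₀ (x + u e₀) + u e₀ = θ₀ x`. [folklore] -/
theorem axisReflection_add_smul_e0 (x : E³) (u : ℝ) :
    axisReflection 0 (x + u • e₀) + u • e₀ = axisReflection 0 x := by
  ext i
  fin_cases i <;> simp

/-- **The sandwich matrix is a column of the OS kernel.** For a translation-invariant family,
`S(θ₀(a + u e₀) ⊔ {w e₂} ⊔ (b + u e₀)) = K(a, spinCons u w b)` (translate by `u e₀` and reassociate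
the blocks). [folklore] -/
theorem sandwichKernel_eq_osPointKernel (S : CorrFamily 3) (hT : IsTranslationInvariant S)
    {u : ℝ} (hu : 0 < u) (w : ℝ) (a b : HalfSpaceConfig 3 0) :
    S (a.n + 1 + b.n) (Fin.append (Fin.append (fun i => axisReflection 0 (a.pts i + u • e₀)) ![w • e₂])
        (fun j => b.pts j + u • e₀)) = osPointKernel S a (b.spinCons hu w) := by
  -- translate by `u e₀`
  rw [← hT (a.n + 1 + b.n) (u • e₀)]
  have h1 : (fun i => Fin.append (Fin.append (fun i => axisReflection 0 (a.pts i + u • e₀)) ![w • e₂])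
      (fun j => b.pts j + u • e₀) i + u • e₀) =
      Fin.append (Fin.append (fun i => axisReflection 0 (a.pts i)) ![u • e₀ + w • e₂])
        (fun j => b.pts j + (2 * u) • e₀) := by
    funext i
    refine Fin.addCases (fun l => ?_) (fun r => ?_) i
    · simp only [Fin.append_left]
      refine Fin.addCases (fun ll => ?_) (fun lr => ?_) l
      · simp only [Fin.append_left, axisReflection_add_smul_e0]
      · simp only [Fin.append_right]
        fin_cases lr
        simp [add_comm]
    · simp only [Fin.append_right]
      rw [add_assoc, ← add_smul]; ring_nf
  rw [h1]
  -- reassociate: `(A ⊔ [p]) ⊔ B = A ⊔ (p :: B)` up to casts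
  unfold osPointKernel
  simp only [HalfSpaceConfig.spinCons_n, HalfSpaceConfig.spinCons_pts]
  rw [Fin.append_assoc, corrFamily_comp_cast S, Fin.append_left_eq_cons, Fin.append_cast_right,
    corrFamily_comp_cast S]
  rfl

/-! ## The boost calculus -/

variable {H : Type*} [NormedAddCommGroup H] [InnerProductSpace ℂ H] [CompleteSpace H]

omit [CompleteSpace H] in
/-- The Gram matrix of kernel vectors of the OS kernel is real. [folklore] -/
theorem im_inner_gen_eq_zero {S : CorrFamily 3} {δ : HalfSpaceConfig 3 0 → H}
    (hK : ∀ a b, ⟪δ a, δ b⟫_ℂ = (osPointKernel S a b : ℂ)) (a b : HalfSpaceConfig 3 0) :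
    (⟪δ a, δ b⟫_ℂ).im = 0 := by
  rw [hK]; exact Complex.ofReal_im _

omit [CompleteSpace H] in
/-- `‖Σ rᵢ δ_{aᵢ}‖² = Σᵢⱼ rᵢ rⱼ K(aᵢ, aⱼ)` for real coefficients. [folklore] -/
theorem norm_sum_smul_gen_sq {S : CorrFamily 3} {δ : HalfSpaceConfig 3 0 → H}
    (hK : ∀ a b, ⟪δ a, δ b⟫_ℂ = (osPointKernel S a b : ℂ)) {k : ℕ} (xs : Fin k → HalfSpaceConfig 3 0)
    (r : Fin k → ℝ) :
    ‖∑ i, (r i : ℂ) • δ (xs i)‖ ^ 2 = ∑ i, ∑ j, r i * r j * osPointKernel S (xs i) (xs j) := by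
  rw [@norm_sq_eq_re_inner ℂ, sum_inner, RCLike.re_to_complex, Complex.re_sum]
  refine Finset.sum_congr rfl fun i _ => ?_
  rw [inner_sum, Complex.re_sum]
  refine Finset.sum_congr rfl fun j _ => ?_
  rw [inner_smul_left, inner_smul_right, hK, Complex.conj_ofReal, ← Complex.ofReal_mul, ← Complex.ofReal_mul,
    Complex.ofReal_re]
  ring

omit [CompleteSpace H] in
/-- `‖Σ rᵢ δ_{aᵢ}‖²` with the OS kernel written out. [folklore] -/
theorem norm_sum_smul_gen_sq' {S : CorrFamily 3} {δ : HalfSpaceConfig 3 0 → H}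
    (hK : ∀ a b, ⟪δ a, δ b⟫_ℂ = (osPointKernel S a b : ℂ)) {k : ℕ} (xs : Fin k → HalfSpaceConfig 3 0)
    (r : Fin k → ℝ) :
    ‖∑ i, (r i : ℂ) • δ (xs i)‖ ^ 2 = ∑ i, ∑ j, r i * r j *
      S ((xs i).n + (xs j).n) (Fin.append (fun l => axisReflection 0 ((xs i).pts l)) (xs j).pts) :=
  norm_sum_smul_gen_sq hK xs r

/-- `osPointKernel` written out. [folklore] -/
theorem osPointKernel_def (S : CorrFamily 3) (a b : HalfSpaceConfig 3 0) :
    osPointKernel S a b = S (a.n + b.n) (Fin.append (fun i => axisReflection 0 (a.pts i)) b.pts) := rfl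

/-- **The boost calculus of a pointwise correlation family along `e₀`.** Given kernel vectors `δ`
of the OS kernel of `S` with dense span, translation invariance, the frame-`e₀` light cone `hLC` and
the two-sided sigma bound `hSB` (constant `C`, exponent `Δ`), and a reservation time `u > 0`, there are
* a cone family `N` with `‖N p‖ ≤ 8` on the tube, holomorphic matrix elements, the reproduction
  `N(t, y) δ_b = δ_{shift t y b}` (`t > 0`) and the reality relation; and
* insertions `B w` with `‖B w‖ ≤ 8 |C| u^{-Δ}`, `B w δ_b = δ_{spinCons u w b}` and real matrix.
[cite: GlimmJaffe1987, §19.5] -/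
theorem exists_boostCalculus (S : CorrFamily 3) {Δ C u : ℝ} (hu : 0 < u)
    (δ : HalfSpaceConfig 3 0 → H) (hδ : DenseRange (Finsupp.linearCombination ℂ δ))
    (hK : ∀ a b, ⟪δ a, δ b⟫_ℂ = (osPointKernel S a b : ℂ)) (hT : IsTranslationInvariant S)
    (hLC : ∀ (m : ℕ) (k : Fin m → ℕ) (A : (a : Fin m) → Fin (k a) → E³) (c : Fin m → ℝ)
      (m' : ℕ) (k' : Fin m' → ℕ) (B : (b : Fin m') → Fin (k' b) → E³) (d : Fin m' → ℝ),
      (∀ a i, 0 < A a i 0) → (∀ b j, 0 < B b j 0) →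
      ∃ G : ℂ × ℂ → ℂ, DifferentiableOn ℂ G {p : ℂ × ℂ | |p.2.im| < p.1.re} ∧
        (∀ t y : ℝ, 0 < t → G ((t : ℂ), (y : ℂ)) =
          ((∑ a, ∑ b, c a * d b * S (k a + k' b)
            (Fin.append (fun i => axisReflection 0 (A a i)) (fun j => B b j + t • e₀ + y • e₁)) : ℝ) : ℂ)) ∧
        (∀ p : ℂ × ℂ, |p.2.im| < p.1.re → ‖G p‖ ^ 2 ≤
          (∑ a, ∑ a', c a * c a' * S (k a + k a') (Fin.append (fun i => axisReflection 0 (A a i)) (A a'))) *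
          (∑ b, ∑ b', d b * d b' * S (k' b + k' b') (Fin.append (fun j => axisReflection 0 (B b j)) (B b')))))
    (hSB : ∀ u v : ℝ, 0 < u → 0 < v → ∀ y : E³, y 0 = 0 →
      ∀ (m : ℕ) (k : Fin m → ℕ) (A : (a : Fin m) → Fin (k a) → E³) (c : Fin m → ℝ)
        (m' : ℕ) (k' : Fin m' → ℕ) (B : (b : Fin m') → Fin (k' b) → E³) (d : Fin m' → ℝ),
        (∀ a i, 0 < A a i 0) → (∀ b j, 0 < B b j 0) →
        (∑ a, ∑ b, c a * d b * S (k a + 1 + k' b)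
            (Fin.append (Fin.append (fun i => axisReflection 0 (A a i + u • e₀)) ![y])
              (fun j => B b j + v • e₀))) ^ 2
          ≤ (C * (u ^ (-Δ) + v ^ (-Δ))) ^ 2 *
            (∑ a, ∑ a', c a * c a' * S (k a + k a') (Fin.append (fun i => axisReflection 0 (A a i)) (A a'))) *
            (∑ b, ∑ b', d b * d b' * S (k' b + k' b') (Fin.append (fun j => axisReflection 0 (B b j)) (B b')))) :
    ∃ (N : ℂ × ℂ → (H →L[ℂ] H)) (B : ℝ → (H →L[ℂ] H)),
      (∀ p : ℂ × ℂ, |p.2.im| < p.1.re → ‖N p‖ ≤ 8) ∧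
      (∀ a b, DifferentiableOn ℂ (fun p => ⟪δ a, N p (δ b)⟫_ℂ) {p : ℂ × ℂ | |p.2.im| < p.1.re}) ∧
      (∀ t y : ℝ, 0 < t → ∀ b, N ((t : ℂ), (y : ℂ)) (δ b) = δ (b.shift t y)) ∧
      (∀ p : ℂ × ℂ, |p.2.im| < p.1.re → ∀ a b,
        ⟪δ a, N (conj p.1, conj p.2) (δ b)⟫_ℂ = conj ⟪δ a, N p (δ b)⟫_ℂ) ∧
      (∀ w, ‖B w‖ ≤ 8 * |C| * u ^ (-Δ)) ∧
      (∀ (w : ℝ) (b : HalfSpaceConfig 3 0), B w (δ b) = δ (b.spinCons hu w)) ∧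
      (∀ (w : ℝ) (a b : HalfSpaceConfig 3 0), (⟪δ a, B w (δ b)⟫_ℂ).im = 0) := by
  have hreal : ∀ a b, (⟪δ a, δ b⟫_ℂ).im = 0 := im_inner_gen_eq_zero hK
  -- the cone family
  obtain ⟨N, hNb, hNd, hNσ, hNc⟩ := exists_coneFamily δ hδ hreal (fun t y b => b.shift t y) (by
    intro k xs r l ys r'
    obtain ⟨G, hGd, hGv, hGb⟩ := hLC k (fun i => (xs i).n) (fun i => (xs i).pts) r
      l (fun j => (ys j).n) (fun j => (ys j).pts) r' (fun i => (xs i).pos) (fun j => (ys j).pos)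
    refine ⟨G, hGd, fun t y ht => ?_, fun p hp => ?_⟩
    · rw [hGv t y ht]
      push_cast
      refine Finset.sum_congr rfl fun i _ => Finset.sum_congr rfl fun j _ => ?_
      rw [hK, osPointKernel_shift S _ _ ht.le]
    · have h2 := hGb p hp
      rw [← norm_sum_smul_gen_sq' hK, ← norm_sum_smul_gen_sq' hK, ← mul_pow] at h2
      exact (pow_le_pow_iff_left₀ (norm_nonneg _) (by positivity) two_ne_zero).1 h2)
  -- the insertions
  have hB : ∀ w : ℝ, ∃ T : H →L[ℂ] H,
      (∀ a b, ⟪δ a, T (δ b)⟫_ℂ = (osPointKernel S a (b.spinCons hu w) : ℝ)) ∧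
      ‖T‖ ≤ 4 * (2 * |C| * u ^ (-Δ)) := by
    intro w
    refine exists_clm_of_real_bound δ hδ hreal (fun a b => osPointKernel S a (b.spinCons hu w))
      (by positivity) fun k xs r l ys r' => ?_
    have key := hSB u u hu hu (w • e₂) (by simp) k (fun i => (xs i).n) (fun i => (xs i).pts) r
      l (fun j => (ys j).n) (fun j => (ys j).pts) r' (fun i => (xs i).pos) (fun j => (ys j).pos)
    simp only [sandwichKernel_eq_osPointKernel S hT hu] at key
    rw [← norm_sum_smul_gen_sq' hK, ← norm_sum_smul_gen_sq' hK, ← mul_pow, ← mul_pow] at key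
    have hpos : (0 : ℝ) ≤ u ^ (-Δ) + u ^ (-Δ) := by positivity
    have h3 := sq_le_sq.1 key
    rw [abs_mul, abs_mul, abs_mul, abs_norm, abs_norm, abs_of_nonneg hpos] at h3
    calc |∑ i, ∑ j, r i * r' j * osPointKernel S (xs i) ((ys j).spinCons hu w)|
        ≤ |C| * (u ^ (-Δ) + u ^ (-Δ)) * ‖∑ i, (r i : ℂ) • δ (xs i)‖ * ‖∑ j, (r' j : ℂ) • δ (ys j)‖ := h3
      _ = 2 * |C| * u ^ (-Δ) * ‖∑ i, (r i : ℂ) • δ (xs i)‖ * ‖∑ j, (r' j : ℂ) • δ (ys j)‖ := by ring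
  choose B hBm hBn using hB
  refine ⟨N, B, hNb, hNd, hNσ, hNc, fun w => ?_, fun w b => ?_, fun w a b => ?_⟩
  · calc ‖B w‖ ≤ 4 * (2 * |C| * u ^ (-Δ)) := hBn w
      _ = 8 * |C| * u ^ (-Δ) := by ring
  · exact ext_inner_gen δ hδ fun a => by rw [hBm, hK]
  · rw [hBm]; exact Complex.ofReal_im _

end Literature.MathematicalPhysics.QuantumFieldTheory
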